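import Literature.Computability.Complexity.ConstantDepthIMMProofs
import HarnessLib

/-!
# Route `DepthWindow` — the Limaye–Srinivasan–Tavenas bound with EXPLICIT constants

Helper file of the route `Theses/DepthWindow.lean` (decomp-valiant workshop, lens 4 = depth-reduction / chasm axis,
generation 3; authored by the lens seat).  The in-tree discharge `lst_constantDepth_imm_lower_bound_holds` of the
LST lower bound hides its constants behind `∃ δ ε d₀`, which suffices for every CONSTANT product-depth
(`perHardConstDepth`, generation 2) but not for a product-depth growing with `n`.  This file opens the constants up:

* `mu_eq_inv` : the exponent of [LimayeSrinivasanTavenas2025, Claim 16] is `μ_Δ = 1/(2^{2Δ+1} - 1)` exactly, hence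
  `inv_two_pow_le_mu : 2^{-(2Δ+1)} ≤ μ_Δ`;
* `final_arith_explicit` : the tree's `LSTWord.final_arith` with its witnesses `δ = μ_Δ/2`, `ε = μ_Δ/(30000 Δ)` and
  the threshold `409600 Δ² + 1440 (Δ+1) ≤ d^{μ_Δ}` moved into the statement (same elementary chain of estimates);
* `lst_explicit` : over a field of characteristic `0`, every product-depth-`≤ Δ` circuit for `IMM_{n,d}` with
  `409600 Δ² + 1440 (Δ+1) ≤ d^{μ_Δ}` and `d ≤ μ_Δ/(30000Δ) · log n` has `≥ n^{d^{μ_Δ/2}}` gates (same assembly of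
  the word-polynomial programme as the tree's `_holds`).

Used by `DepthWindowGrowing.lean` (the growing-depth rung `perHardGrowingDepth` of the crux `PerHardLog3`).
Unconditional, 0 sorry, def-free, closes no item.

References: [LimayeSrinivasanTavenas2025] J. ACM 72 (2025) Art. 26, Cor. 4 (p. 26:5, 26:13), Lemma 15, Claim 16.
-/

-- layout Summits/ValiantsHypothesis/ValiantsHypothesis forces the duplicated namespace component
set_option linter.dupNamespace false

namespace Summit.ValiantsHypothesis.ValiantsHypothesis.Theorems.DepthWindow

open MvPolynomial Real Literature.Computability.AlgebraicComplexity ArithCircuit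
open Literature.Computability.AlgebraicComplexity.LSTWord
open Literature.Computability.Complexity

noncomputable section

universe u

/-! ### The exponents `μ_Δ` in closed form -/

/-- `μ_p = 1 / (2^{2p+1} - 1)` (`μ_0 = 1`, `μ_1 = 1/7`, `μ_2 = 1/31`, …): the recursion
`μ_{p+1} = μ_p/(4+3μ_p)` sends `1/q` to `1/(4q+3)`. [cite: LimayeSrinivasanTavenas2025, Claim 16] -/
theorem mu_eq_inv (p : ℕ) : mu p = 1 / ((2 : ℝ) ^ (2 * p + 1) - 1) := by
  induction p with
  | zero => norm_num [mu]
  | succ p ih =>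
    simp only [mu]
    rw [ih]
    have hq : (1 : ℝ) < (2 : ℝ) ^ (2 * p + 1) := one_lt_pow₀ (by norm_num) (by omega)
    have hq' : (2 : ℝ) ^ (2 * (p + 1) + 1) = 4 * (2 : ℝ) ^ (2 * p + 1) := by
      rw [show 2 * (p + 1) + 1 = (2 * p + 1) + 2 by ring, pow_add]; ring
    rw [hq']
    have h1 : (2 : ℝ) ^ (2 * p + 1) - 1 ≠ 0 := by linarith
    have h2 : 4 * (2 : ℝ) ^ (2 * p + 1) - 1 ≠ 0 := by linarith
    field_simp
    ring

/-- `2^{-(2p+1)} ≤ μ_p`. [cite: LimayeSrinivasanTavenas2025, Claim 16] -/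
theorem inv_two_pow_le_mu (p : ℕ) : 1 / ((2 : ℝ) ^ (2 * p + 1)) ≤ mu p := by
  rw [mu_eq_inv]
  have hq : (1 : ℝ) < (2 : ℝ) ^ (2 * p + 1) := one_lt_pow₀ (by norm_num) (by omega)
  exact one_div_le_one_div_of_le (by linarith) (by linarith)

/-! ### The Limaye–Srinivasan–Tavenas estimate with explicit constants -/

-- `final_arith_explicit` is the in-tree `LSTWord.final_arith` with its witnesses `δ = μ/2`,
-- `ε = μ/(30000 Δ)`, `d^μ ≥ 409600 Δ² + 1440 (Δ+1)` moved into the statement; the proof is the same long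
-- chain of elementary real-arithmetic steps and needs the same heartbeat budget (no linter is disabled).
set_option maxHeartbeats 1600000 in
/-- **The final LST estimate, constants exposed** (LST 2025, proof of Cor. 4, p. 26:13): for `Δ ≥ 1`,
`μ = μ_Δ`, whenever `1 ≤ d`, `409600 Δ² + 1440 (Δ+1) ≤ d^μ`, `d ≤ μ/(30000Δ) · (k+1)`, `1 ≤ k`,
`N + 1 ≤ 2^{6k}`, `√n ≤ 2^k`, `2 ≤ n` and `2^{-k/2} ≤ Λ_Δ(s, N, d) Φ_Δ(d)`, then `n^{d^{μ/2}} ≤ s`.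
[cite: LimayeSrinivasanTavenas2025, Cor. 4] -/
theorem final_arith_explicit {Δ : ℕ} (hΔ : 1 ≤ Δ) (n d s N k : ℕ) (hd1 : 1 ≤ d)
    (hdμ' : 409600 * (Δ : ℝ) ^ 2 + 1440 * ((Δ : ℝ) + 1) ≤ (d : ℝ) ^ mu Δ)
    (hdk : (d : ℝ) ≤ mu Δ / (30000 * Δ) * ((k : ℝ) + 1)) (hk1 : 1 ≤ k)
    (hN : (N : ℝ) + 1 ≤ (2 : ℝ) ^ (6 * (k : ℝ))) (hsqrt : Real.sqrt n ≤ (2 : ℝ) ^ (k : ℝ))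
    (hn2 : (2 : ℝ) ≤ n) (hstar : (2 : ℝ) ^ (-(k : ℝ) / 2) ≤ Lam s N d Δ * Phi k Δ d) :
    (n : ℝ) ^ ((d : ℝ) ^ (mu Δ / 2)) ≤ s := by
  obtain ⟨μ, hμdef⟩ : ∃ μ : ℝ, mu Δ = μ := ⟨_, rfl⟩
  rw [hμdef] at hdμ' hdk ⊢
  have hμ0 : 0 < μ := hμdef ▸ mu_pos Δ
  have hμ1 : μ ≤ 1 := hμdef ▸ mu_le_one Δ
  have hΔR : (1 : ℝ) ≤ Δ := by exact_mod_cast hΔ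
  obtain ⟨ε, hεdef⟩ : ∃ ε : ℝ, μ / (30000 * Δ) = ε := ⟨_, rfl⟩
  rw [hεdef] at hdk
  have hε0 : 0 < ε := by rw [← hεdef]; positivity
  have hε40 : ε ≤ 1 / 40 := by
    rw [← hεdef, div_le_div_iff₀ (by positivity) (by norm_num)]; nlinarith
  obtain ⟨Cst, hCst⟩ : ∃ C : ℝ, 409600 * (Δ : ℝ) ^ 2 + 1440 * ((Δ : ℝ) + 1) = C := ⟨_, rfl⟩
  have hCst0 : 0 ≤ Cst := by rw [← hCst]; positivity
  -- basic positivity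
  have hdR : (1 : ℝ) ≤ d := by exact_mod_cast hd1
  have hkR : (1 : ℝ) ≤ k := by exact_mod_cast hk1
  have hdμ : Cst ≤ (d : ℝ) ^ μ := hCst ▸ hdμ'
  have hdμ1 : (1 : ℝ) ≤ (d : ℝ) ^ μ := Real.one_le_rpow hdR hμ0.le
  have hdμ2 : (1 : ℝ) ≤ (d : ℝ) ^ (μ / 2) := Real.one_le_rpow hdR (by positivity)
  have hsq : ((d : ℝ) ^ (μ / 2)) ^ 2 = (d : ℝ) ^ μ := by
    rw [← Real.rpow_natCast, ← Real.rpow_mul (by linarith)]; congr 1; push_cast; ring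
  -- `E = k d^μ`
  obtain ⟨E, hE⟩ : ∃ E : ℝ, (k : ℝ) * (d : ℝ) ^ μ = E := ⟨_, rfl⟩
  have hE0 : 0 ≤ E := by rw [← hE]; positivity
  have hEk : (k : ℝ) * Cst ≤ E := by rw [← hE]; exact mul_le_mul_of_nonneg_left hdμ (by linarith)
  -- Step 1: `2^{E/40} ≤ Λ`
  obtain ⟨Λ, hΛdef⟩ : ∃ L : ℝ, Lam s N d Δ = L := ⟨_, rfl⟩
  have hΛ1 : 1 ≤ Λ := hΛdef ▸ one_le_Lam _ _ _ _
  have hstep1 : (2 : ℝ) ^ (E / 40) ≤ Λ := by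
    have hPhi : Phi k Δ (d : ℝ) = (2 : ℝ) ^ (-(E / 20)) := by
      unfold Phi; rw [hμdef]; congr 1; rw [← hE]; ring
    rw [hPhi, hΛdef] at hstar
    have h1 : (2 : ℝ) ^ (-(k : ℝ) / 2 + E / 20) ≤ Λ := by
      rw [Real.rpow_add two_pos]
      calc (2 : ℝ) ^ (-(k : ℝ) / 2) * (2 : ℝ) ^ (E / 20)
          ≤ Λ * (2 : ℝ) ^ (-(E / 20)) * (2 : ℝ) ^ (E / 20) :=
            mul_le_mul_of_nonneg_right hstar (by positivity)
        _ = Λ := by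
            rw [mul_assoc, ← Real.rpow_add two_pos, neg_add_cancel, Real.rpow_zero, mul_one]
    refine le_trans (two_rpow_le_two_rpow ?_) h1
    -- `E/40 ≤ -k/2 + E/20` iff `20 k ≤ E`, from `d^μ ≥ 20`
    have : (20 : ℝ) * k ≤ E := by
      have h20 : (20 : ℝ) ≤ Cst := by rw [← hCst]; nlinarith
      nlinarith
    linarith
  -- Step 2: `Λ ≤ 2^Δ (s+1)^{2Δ} (N+1)^{Δ+1} (d+1)^{(5d+1)Δ}`
  have hs0 : (0 : ℝ) ≤ s := Nat.cast_nonneg s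
  have hN0 : (0 : ℝ) ≤ N := Nat.cast_nonneg N
  obtain ⟨P, hP⟩ : ∃ P : ℝ, P = ((d : ℝ) + 1) ^ (5 * d + 1) := ⟨_, rfl⟩
  have hP1 : (1 : ℝ) ≤ P := by rw [hP]; exact one_le_pow₀ (by linarith)
  have hP0 : (0 : ℝ) < P := by linarith
  have hΛle : Λ ≤ (2 : ℝ) ^ Δ * ((s : ℝ) + 1) ^ (2 * Δ) * ((N : ℝ) + 1) ^ (Δ + 1) * P ^ Δ := by
    rw [← hΛdef, Lam_eq]
    have hsc := stepConst_le s N d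
    rw [← hP] at hsc
    calc (stepConst s N d : ℝ) ^ Δ * ((N : ℝ) + 1)
        ≤ (2 * ((s : ℝ) + 1) ^ 2 * ((N : ℝ) + 1) * P) ^ Δ * ((N : ℝ) + 1) :=
          mul_le_mul_of_nonneg_right (pow_le_pow_left₀ (Nat.cast_nonneg _) hsc Δ) (by positivity)
      _ = (2 : ℝ) ^ Δ * ((s : ℝ) + 1) ^ (2 * Δ) * ((N : ℝ) + 1) ^ (Δ + 1) * P ^ Δ := by
          rw [mul_pow, mul_pow, mul_pow, ← pow_mul, pow_succ]; ring
  -- Step 3: the three junk factors are `≤ 2^{E/240}` each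
  have hj1 : (2 : ℝ) ^ Δ ≤ (2 : ℝ) ^ (E / 240) := by
    rw [← Real.rpow_natCast]
    refine two_rpow_le_two_rpow ?_
    have h240 : (240 : ℝ) * Δ ≤ Cst := by rw [← hCst]; nlinarith
    have hkC : Cst ≤ (k : ℝ) * Cst := le_mul_of_one_le_left hCst0 hkR
    linarith
  have hj2 : ((N : ℝ) + 1) ^ (Δ + 1) ≤ (2 : ℝ) ^ (E / 240) := by
    calc ((N : ℝ) + 1) ^ (Δ + 1) ≤ ((2 : ℝ) ^ (6 * (k : ℝ))) ^ (Δ + 1) :=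
          pow_le_pow_left₀ (by positivity) hN _
      _ = (2 : ℝ) ^ (6 * (k : ℝ) * (Δ + 1)) := by
          rw [← Real.rpow_natCast, ← Real.rpow_mul (by norm_num)]; push_cast; ring_nf
      _ ≤ (2 : ℝ) ^ (E / 240) := two_rpow_le_two_rpow (by
          have h1440 : (1440 : ℝ) * ((Δ : ℝ) + 1) ≤ Cst := by rw [← hCst]; nlinarith
          have hkE : (k : ℝ) * (1440 * ((Δ : ℝ) + 1)) ≤ E :=
            le_trans (mul_le_mul_of_nonneg_left h1440 (by linarith)) hEk
          linarith)
  have hj3 : P ^ Δ ≤ (2 : ℝ) ^ (E / 240) := by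
    -- compare logarithms
    have hPΔ : 0 < P ^ Δ := pow_pos hP0 Δ
    have h2E : (0 : ℝ) < (2 : ℝ) ^ (E / 240) := Real.rpow_pos_of_pos two_pos _
    rw [← Real.log_le_log_iff hPΔ h2E, Real.log_pow, Real.log_rpow two_pos]
    have hlogP : Real.log P = ((5 * d + 1 : ℕ) : ℝ) * Real.log ((d : ℝ) + 1) := by
      rw [hP, Real.log_pow]
    rw [hlogP]
    have hlog := log_succ_le hμ0 hμ1 hd1
    have hlog2 : (1 / 2 : ℝ) ≤ Real.log 2 := by
      have := Real.log_two_gt_d9; linarith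
    -- `d ≤ 2 ε k`
    have hdk2 : (d : ℝ) ≤ 2 * ε * k := by nlinarith
    -- LHS ≤ Δ (5d+1) (4/μ) d^{μ/2} ≤ (24 Δ/μ) d^{1+μ/2}
    have h5 : ((5 * d + 1 : ℕ) : ℝ) ≤ 6 * d := by push_cast; linarith
    have hl0 : 0 ≤ Real.log ((d : ℝ) + 1) := Real.log_nonneg (by linarith)
    have hdd : 0 ≤ (d : ℝ) * (d : ℝ) ^ (μ / 2) := by positivity
    have hlhs : (Δ : ℝ) * (((5 * d + 1 : ℕ) : ℝ) * Real.log ((d : ℝ) + 1)) ≤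
        24 * Δ / μ * ((d : ℝ) * (d : ℝ) ^ (μ / 2)) := by
      have h1 : ((5 * d + 1 : ℕ) : ℝ) * Real.log ((d : ℝ) + 1) ≤
          (6 * d) * (4 / μ * (d : ℝ) ^ (μ / 2)) := mul_le_mul h5 hlog hl0 (by positivity)
      have h2 : (Δ : ℝ) * ((6 * d) * (4 / μ * (d : ℝ) ^ (μ / 2))) =
          24 * Δ / μ * ((d : ℝ) * (d : ℝ) ^ (μ / 2)) := by ring
      rw [← h2]
      exact mul_le_mul_of_nonneg_left h1 (by positivity)
    -- RHS ≥ 2 ε E ≥ d d^μ … in the form `d d^μ/(960 ε) ≤ E/240 · log 2`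
    have hrhs : (d : ℝ) * (d : ℝ) ^ μ / (960 * ε) ≤ E / 240 * Real.log 2 := by
      have hdμ0 : 0 ≤ (d : ℝ) ^ μ := by positivity
      have h1 : (d : ℝ) * (d : ℝ) ^ μ ≤ 2 * ε * E := by
        rw [← hE]
        have := mul_le_mul_of_nonneg_right hdk2 hdμ0
        nlinarith
      rw [div_le_iff₀ (by positivity)]
      have h2 : E * ε * (1 / 2) ≤ E * ε * Real.log 2 :=
        mul_le_mul_of_nonneg_left hlog2 (by positivity)
      nlinarith
    -- compare: `24Δ/μ · d^{1+μ/2} ≤ d^{1+μ}/(960 ε)` since `d^{μ/2} ≥ 1` and `ε = μ/(30000Δ)`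
    have hmid : 24 * Δ / μ * ((d : ℝ) * (d : ℝ) ^ (μ / 2)) ≤ (d : ℝ) * (d : ℝ) ^ μ / (960 * ε) := by
      rw [le_div_iff₀ (by positivity), ← hsq]
      have hprod : 30000 * (Δ : ℝ) * ε = μ := by
        rw [← hεdef]; exact mul_div_cancel₀ μ (by positivity)
      have hcoef : 24 * (Δ : ℝ) / μ * (960 * ε) ≤ 1 := by
        rw [div_mul_eq_mul_div, div_le_one hμ0]
        have : (0 : ℝ) ≤ (Δ : ℝ) * ε := by positivity
        nlinarith
      calc 24 * Δ / μ * ((d : ℝ) * (d : ℝ) ^ (μ / 2)) * (960 * ε)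
          = (24 * (Δ : ℝ) / μ * (960 * ε)) * ((d : ℝ) * (d : ℝ) ^ (μ / 2)) := by ring
        _ ≤ 1 * ((d : ℝ) * (d : ℝ) ^ (μ / 2)) := mul_le_mul_of_nonneg_right hcoef hdd
        _ ≤ (d : ℝ) * ((d : ℝ) ^ (μ / 2)) ^ 2 := by
            rw [one_mul, sq, ← mul_assoc]
            exact le_mul_of_one_le_right hdd hdμ2
    linarith
  -- Step 4: `(s+1)^{2Δ} ≥ 2^{E/80}`
  have hstep4 : (2 : ℝ) ^ (E / 80) ≤ ((s : ℝ) + 1) ^ (2 * Δ) := by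
    have hjunk : (2 : ℝ) ^ Δ * ((N : ℝ) + 1) ^ (Δ + 1) * P ^ Δ ≤ (2 : ℝ) ^ (E / 80) := by
      calc (2 : ℝ) ^ Δ * ((N : ℝ) + 1) ^ (Δ + 1) * P ^ Δ
          ≤ (2 : ℝ) ^ (E / 240) * (2 : ℝ) ^ (E / 240) * (2 : ℝ) ^ (E / 240) :=
            mul_le_mul (mul_le_mul hj1 hj2 (by positivity) (by positivity)) hj3 (by positivity)
              (by positivity)
        _ = (2 : ℝ) ^ (E / 80) := by
            rw [← Real.rpow_add (by norm_num), ← Real.rpow_add (by norm_num)]; congr 1; ring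
    have h := hstep1.trans hΛle
    -- `2^{E/40} ≤ (s+1)^{2Δ} · 2^{E/80}`
    have h' : (2 : ℝ) ^ (E / 40) ≤ ((s : ℝ) + 1) ^ (2 * Δ) * (2 : ℝ) ^ (E / 80) := by
      calc (2 : ℝ) ^ (E / 40) ≤ (2 : ℝ) ^ Δ * ((s : ℝ) + 1) ^ (2 * Δ) * ((N : ℝ) + 1) ^ (Δ + 1) * P ^ Δ := h
        _ = ((s : ℝ) + 1) ^ (2 * Δ) * ((2 : ℝ) ^ Δ * ((N : ℝ) + 1) ^ (Δ + 1) * P ^ Δ) := by ring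
        _ ≤ ((s : ℝ) + 1) ^ (2 * Δ) * (2 : ℝ) ^ (E / 80) :=
            mul_le_mul_of_nonneg_left hjunk (by positivity)
    have hsplit : (2 : ℝ) ^ (E / 40) = (2 : ℝ) ^ (E / 80) * (2 : ℝ) ^ (E / 80) := by
      rw [← Real.rpow_add (by norm_num)]; congr 1; ring
    rw [hsplit] at h'
    exact le_of_mul_le_mul_right h' (by positivity)
  -- Step 5: `s + 1 ≥ 2^{E/(160Δ)} ≥ n^{d^μ/(320Δ)} ≥ n^{2 d^{μ/2}}`
  have hstep5 : (2 : ℝ) ^ (E / (160 * Δ)) ≤ (s : ℝ) + 1 := by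
    have h1 : ((2 : ℝ) ^ (E / (160 * Δ))) ^ (2 * Δ) = (2 : ℝ) ^ (E / 80) := by
      rw [← Real.rpow_natCast, ← Real.rpow_mul (by norm_num)]
      congr 1
      push_cast
      rw [div_mul_eq_mul_div, div_eq_div_iff (by positivity) (by norm_num)]
      ring
    rw [← h1] at hstep4
    exact le_of_pow_le_pow_left₀ (by omega) (by positivity) hstep4
  have hn1 : (1 : ℝ) ≤ n := by linarith
  have hstep6 : (n : ℝ) ^ (2 * (d : ℝ) ^ (μ / 2)) ≤ (s : ℝ) + 1 := by
    refine le_trans ?_ hstep5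
    calc (n : ℝ) ^ (2 * (d : ℝ) ^ (μ / 2)) ≤ (n : ℝ) ^ ((d : ℝ) ^ μ / (320 * Δ)) := by
          refine Real.rpow_le_rpow_of_exponent_le hn1 ?_
          rw [le_div_iff₀ (by positivity), ← hsq]
          have h640 : (640 : ℝ) * Δ ≤ (d : ℝ) ^ (μ / 2) := by
            have : (640 * (Δ : ℝ)) ^ 2 ≤ ((d : ℝ) ^ (μ / 2)) ^ 2 := by
              rw [hsq]; refine le_trans ?_ hdμ; rw [← hCst]; nlinarith
            exact (pow_le_pow_iff_left₀ (by positivity) (by positivity) two_ne_zero).1 this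
          nlinarith
      _ = ((Real.sqrt n) ^ 2) ^ ((d : ℝ) ^ μ / (320 * Δ)) := by rw [Real.sq_sqrt (by linarith)]
      _ = (Real.sqrt n) ^ ((d : ℝ) ^ μ / (160 * Δ)) := by
          rw [← Real.rpow_natCast, ← Real.rpow_mul (Real.sqrt_nonneg _)]
          congr 1
          push_cast
          rw [mul_div_assoc', div_eq_div_iff (by positivity) (by positivity)]
          ring
      _ ≤ ((2 : ℝ) ^ (k : ℝ)) ^ ((d : ℝ) ^ μ / (160 * Δ)) :=
          Real.rpow_le_rpow (Real.sqrt_nonneg _) hsqrt (by positivity)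
      _ = (2 : ℝ) ^ (E / (160 * Δ)) := by
          rw [← Real.rpow_mul (by norm_num)]; congr 1; rw [← hE]; ring
  -- Step 6: `n^{2x} ≥ n^x + 1`
  have hx : (2 : ℝ) ≤ (n : ℝ) ^ ((d : ℝ) ^ (μ / 2)) := by
    calc (2 : ℝ) ≤ n := hn2
      _ = (n : ℝ) ^ (1 : ℝ) := (Real.rpow_one _).symm
      _ ≤ (n : ℝ) ^ ((d : ℝ) ^ (μ / 2)) := Real.rpow_le_rpow_of_exponent_le hn1 hdμ2
  have hfin : (n : ℝ) ^ ((d : ℝ) ^ (μ / 2)) + 1 ≤ (n : ℝ) ^ (2 * (d : ℝ) ^ (μ / 2)) := by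
    rw [show 2 * (d : ℝ) ^ (μ / 2) = (d : ℝ) ^ (μ / 2) + (d : ℝ) ^ (μ / 2) by ring,
      Real.rpow_add (by linarith)]
    nlinarith
  linarith

/-- **Limaye–Srinivasan–Tavenas with explicit constants**: over a field of characteristic `0`, for `Δ ≥ 1`
and `μ = μ_Δ = 1/(2^{2Δ+1}-1)`: every circuit of product-depth `≤ Δ` computing `IMM_{n,d}` with `1 ≤ d`,
`409600 Δ² + 1440 (Δ+1) ≤ d^μ` and `d ≤ μ/(30000 Δ) · log n` has at least `n^{d^{μ/2}}` gates (the in-tree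
`lst_constantDepth_imm_lower_bound_holds` with its `∃ δ ε d₀` opened up; same assembly of the programme).
[cite: LimayeSrinivasanTavenas2025, Cor. 4] -/
theorem lst_explicit (K : Type u) [Field K] [CharZero K] {Δ : ℕ} (hΔ : 1 ≤ Δ) (n d : ℕ) (hd1 : 1 ≤ d)
    (hdμ : 409600 * (Δ : ℝ) ^ 2 + 1440 * ((Δ : ℝ) + 1) ≤ (d : ℝ) ^ mu Δ)
    (hdn : (d : ℝ) ≤ mu Δ / (30000 * Δ) * Real.log n)
    (C : ArithCircuit K (Fin d × Fin n × Fin n)) (hCΔ : C.productDepth ≤ Δ)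
    (hC : C.Computes (immPoly n d K)) :
    (n : ℝ) ^ ((d : ℝ) ^ (mu Δ / 2)) ≤ (C.size : ℝ) := by
  obtain ⟨ε, hεdef⟩ : ∃ ε : ℝ, mu Δ / (30000 * Δ) = ε := ⟨_, rfl⟩
  rw [hεdef] at hdn
  have hΔR : (1 : ℝ) ≤ Δ := by exact_mod_cast hΔ
  have hμ0 : 0 < mu Δ := mu_pos Δ
  have hμ1 : mu Δ ≤ 1 := mu_le_one Δ
  have hε : 0 < ε := by rw [← hεdef]; positivity
  have hε40 : ε ≤ 1 / 40 := by
    rw [← hεdef, div_le_div_iff₀ (by positivity) (by norm_num)]; nlinarith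
  have hdR : (1 : ℝ) ≤ d := by exact_mod_cast hd1
  -- `log n ≥ d/ε ≥ 40`
  have hlog : (40 : ℝ) ≤ Real.log n := by
    have h1 : (d : ℝ) ≤ (1 / 40) * Real.log n := hdn.trans (by
      have := Real.log_nonneg (show (1 : ℝ) ≤ max (n : ℝ) 1 from le_max_right _ _)
      by_cases hn : (1 : ℝ) ≤ n
      · exact mul_le_mul_of_nonneg_right hε40 (Real.log_nonneg hn)
      · push Not at hn
        have : Real.log n ≤ 0 := Real.log_nonpos (Nat.cast_nonneg n) hn.le
        nlinarith)
    linarith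
  have hn2R : (2 : ℝ) ≤ n := by
    by_contra h
    push Not at h
    have : Real.log n < Real.log 2 := by
      rcases Nat.eq_zero_or_pos n with hn | hn
      · subst hn; simp; exact Real.log_pos one_lt_two
      · exact Real.log_lt_log (by exact_mod_cast hn) h
    have := Real.log_two_lt_d9
    linarith
  have hn0 : n ≠ 0 := by rintro rfl; simp at hn2R; linarith
  -- `k = ⌊log₂ n⌋`
  set k := Nat.log 2 n with hk
  have h2k : ((2 : ℕ) ^ k : ℕ) ≤ n := Nat.pow_log_le_self 2 hn0
  have hn2k : n < 2 ^ (k + 1) := Nat.lt_pow_succ_log_self one_lt_two n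
  have h2kR : (2 : ℝ) ^ (k : ℝ) ≤ n := by rw [Real.rpow_natCast]; exact_mod_cast h2k
  have hn2kR : (n : ℝ) < (2 : ℝ) ^ ((k : ℝ) + 1) := by
    rw [show (k : ℝ) + 1 = ((k + 1 : ℕ) : ℝ) by push_cast; ring, Real.rpow_natCast]
    exact_mod_cast hn2k
  have hlogk : Real.log n ≤ (k : ℝ) + 1 := by
    have h1 : Real.log n ≤ Real.log ((2 : ℝ) ^ ((k : ℝ) + 1)) :=
      Real.log_le_log (by linarith) hn2kR.le
    rw [Real.log_rpow (by norm_num)] at h1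
    have := Real.log_two_lt_d9
    have hk0 : (0 : ℝ) ≤ (k : ℝ) + 1 := by positivity
    nlinarith
  have hdk : (d : ℝ) ≤ ε * ((k : ℝ) + 1) := hdn.trans (mul_le_mul_of_nonneg_left hlogk hε.le)
  have h10 : 10 * d ≤ k := by
    have : (40 : ℝ) * d ≤ (k : ℝ) + 1 := by nlinarith
    have : 40 * d ≤ k + 1 := by exact_mod_cast this
    omega
  have hk1 : 1 ≤ k := le_trans (by omega) h10
  -- the greedy `k`-unbiased word and the word substitution
  set pos := greedyWord d k with hpos
  have hover : ∀ t, t ≤ d → overLen k pos t ≤ k := by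
    intro t ht
    rw [overLen_eq_natAbs k pos t ht]
    have h := abs_prefixSum_greedyWord_le d k t ht
    rw [← hpos, abs_le] at h
    omega
  have hn' : ∀ t, t ≤ d → 2 ^ overLen k pos t ≤ n := fun t ht =>
    (Nat.pow_le_pow_right Nat.two_pos (hover t ht)).trans h2k
  have hg := isBlockPreserving_wordSubst k pos K hn'
  have heval : aeval (wordSubst k pos K hn') C.eval = wordPoly k pos K := by
    rw [show C.eval = immPoly n d K from hC]
    exact aeval_wordSubst_immPoly k pos K hn' hd1
  have hup := relRank_aeval_eval_le (P := C) hg h10 hd1 hCΔ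
  rw [heval] at hup
  have hlow := relRank_wordPoly_ge k pos K (hover d le_rfl)
  have hstar := hlow.trans hup
  -- the remaining numeric hypotheses
  have hN : ((Fintype.card (Fin d × Fin n × Fin n) : ℕ) : ℝ) + 1 ≤ (2 : ℝ) ^ (6 * (k : ℝ)) := by
    rw [Fintype.card_prod, Fintype.card_prod, Fintype.card_fin, Fintype.card_fin]
    push_cast
    have hdn' : (d : ℝ) + 1 ≤ n := by
      have := Real.add_one_le_exp (Real.log n)
      rw [Real.exp_log (by linarith)] at this
      have : (d : ℝ) ≤ (1 / 40) * Real.log n := by nlinarith [hdk, hlogk]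
      linarith
    have hn1 : (1 : ℝ) ≤ n := by linarith
    calc (d : ℝ) * ((n : ℝ) * n) + 1 ≤ (n - 1) * (n * n) + n * n := by nlinarith
      _ = (n : ℝ) ^ 3 := by ring
      _ ≤ ((2 : ℝ) ^ ((k : ℝ) + 1)) ^ 3 := pow_le_pow_left₀ (by linarith) hn2kR.le 3
      _ = (2 : ℝ) ^ (3 * ((k : ℝ) + 1)) := by
          rw [← Real.rpow_natCast, ← Real.rpow_mul (by norm_num)]; congr 1; push_cast; ring
      _ ≤ (2 : ℝ) ^ (6 * (k : ℝ)) := two_rpow_le_two_rpow (by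
          have : (1 : ℝ) ≤ k := by exact_mod_cast hk1
          linarith)
  have hsqrt : Real.sqrt n ≤ (2 : ℝ) ^ (k : ℝ) := by
    -- `√n ≤ n/2 ≤ 2^k` as `n ≥ 4`
    have hn4 : (4 : ℝ) ≤ n := by
      have := Real.add_one_le_exp (Real.log n)
      rw [Real.exp_log (by linarith)] at this
      linarith
    have h1 : Real.sqrt n ≤ n / 2 := by
      calc Real.sqrt n ≤ Real.sqrt (((n : ℝ) / 2) ^ 2) := Real.sqrt_le_sqrt (by nlinarith)
        _ = n / 2 := Real.sqrt_sq (by positivity)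
    have h2 : (n : ℝ) / 2 ≤ (2 : ℝ) ^ (k : ℝ) := by
      rw [div_le_iff₀ (by norm_num)]
      have : (2 : ℝ) ^ ((k : ℝ) + 1) = (2 : ℝ) ^ (k : ℝ) * 2 := by
        rw [Real.rpow_add (by norm_num), Real.rpow_one]
      linarith
    exact h1.trans h2
  exact final_arith_explicit hΔ n d C.size (Fintype.card (Fin d × Fin n × Fin n)) k hd1 hdμ
    (by rw [hεdef]; exact hdk) hk1 hN hsqrt hn2R hstar

end

end Summit.ValiantsHypothesis.ValiantsHypothesis.Theorems.DepthWindow
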